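import Mathlib
import Summits.ValiantsHypothesis.ValiantsHypothesis.Theorems.GrenetZeonTransferToDc
import Literature.Computability.AlgebraicComplexity.AlgDetRepr
import HarnessLib

/-!
# Crux `GrenetZeon.AbelianizationQP` (stmt-ValiantsHypothesis-8063) — RELATIVE TRANSFER:
# de-algebraizing the top of a tower of coefficient algebras (partial de-algebraization along a
# tensor factor)

The route's proved `TransferToDc` (stmt-8069, `transferToDc_proof`) removes a commutative coefficient
algebra `R` of `ℂ`-dimension `s` from an `m × m` affine determinant at cost `(s+1)(m+1)^3` in the
matrix size, landing at `s = 1`.  This file proves the RELATIVE version asked for by the 8063 census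
(evidence-8063-leafhand5-g1.md, "partial de-algebraization along a tensor factor"): only the TOP of a
tower `ℂ → R₂ → R` is removed, landing on the intermediate algebra `R₂`.

* `hasAlgDetRepr_of_tower` — **relative transfer.** Let `R₂` be a finite commutative `k`-algebra
  (`k` a field) with `finrank_k R₂ ≤ s`, `R` a commutative `R₂`-algebra which is FREE of rank `r` over
  `R₂` (basis indexed by a finite type `β`, `|β| = r`), `λ₁ : R → R₂` an `R₂`-linear retraction-type
  functional and `λ₂ : R₂ → k` a `k`-linear functional.  If `f = λ₂ (λ₁ (det A))` coefficientwise for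
  an affine `m × m` matrix `A` over `R[x]`, then `HasAlgDetRepr f ((m^3 + 2)·r + 3) s`: the coefficient
  algebra shrinks from `R` (of `k`-dimension `r·dim R₂`) to `R₂` at polynomial cost in `(m, r)`.
  Proof = the proof of `TransferToDc` run over the base ring `R₂` instead of `k`: Mahajan–Vinay's
  division-free determinant program (`layeredABPComputes_detPoly_of_algebra`, base-changed to `R`),
  affine substitution, regular-representation unrolling along the basis `b` with the `R₂`-linear
  read-out `λ₁` (`LayeredABPComputes.restrictScalars`, stated in the tree over any commutative base),
  closure into one affine determinant over `R₂` (`LayeredABPComputes.hasDetRepr`), read through `λ₂`.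
* `hasAlgDetRepr_of_tensor` — **the tensor-factor instance.** For finite commutative `ℂ`-algebras
  `R₁`, `R₂` with functionals `λ₁`, `λ₂` and an affine `m × m` matrix `A` over `(R₂ ⊗ R₁)[x]` with
  `f = (λ₂ ⊗ λ₁)(det A)` coefficientwise (a PURE-TENSOR read-out), `f` has an
  `((m^3 + 2)·dim R₁ + 3, dim R₂)`-representation: `(m, s₁ s₂) ↦ (poly(m, s₁), s₂)` along the chart.
  (A general functional on `R₂ ⊗ R₁` is a sum of `≤ min(s₁, s₂)` pure tensors; with the additivity
  `hasAlgDetRepr_add` of `GrenetZeonPolySizeQPAlgebraSumsOfDeterminants.lean` this gives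
  `(poly(m, s₁), s₂ · min(s₁, s₂))` over a power of `R₂` — not restated here.)

Reading for 8063 (no claim beyond the lemma): abelianization witnesses with a tensor (or any free
tower) structure slide DOWN the `s`-axis at polynomial cost in the rank removed; e.g. a witness over
`Z_a ⊗ Z_b` (zeons, `s = 2^(a+b)`) with pure read-out gives `((m^3+2)·2^a + 3, 2^b)`, the same curve
`m · s ≈ poly(n) · 2^n` as the hybrid construction (`GrenetZeonAbelianizationQPHybridCurve.lean`) up
to the polynomial factor.  The registered stub `stub_subexpAbelianization` (≡ the crux) is untouched;
nothing here bears on VP ≠ VNP.  (The Mahajan–Vinay bookkeeping `layeredABPComputes_detPoly_of_algebra`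
is reused from `GrenetZeonTransferToDc.lean`, hence the route-file import.)  Axioms `propext`,
`Classical.choice`, `Quot.sound`.

References: M. Mahajan, V. Vinay, *Determinant: combinatorics, algorithms, and complexity*, Chicago
J. TCS 1997, §3; P. Hrubeš, A. Yehudayoff, *Arithmetic complexity in ring extensions*, Theory of
Computing 7 (2011), Thm. 1.1, §4; C. Ikenmeyer, J. M. Landsberg, *On the complexity of the permanent
in various computational models*, JPAA 221 (2017), Thm. 4.1.
-/

set_option linter.dupNamespace false

noncomputable section

namespace Summit.ValiantsHypothesis.ValiantsHypothesis.Theorems.GrenetZeonAbelianizationQP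

open MvPolynomial Matrix TensorProduct
open Literature.Computability.AlgebraicComplexity
open Summit.ValiantsHypothesis.ValiantsHypothesis.Theorems.GrenetZeon

/-! ### Relative transfer along a tower `k → R₂ → R` -/

section Tower

variable {k : Type} [Field k] {σ : Type*}

/-- Coefficients of the coefficientwise image of a polynomial under an additive map. [folklore] -/
theorem coeff_map_toAddMonoidHom {R R₂ : Type} [CommRing R] [CommRing R₂] [Algebra R₂ R]
    (l : R →ₗ[R₂] R₂) (P : MvPolynomial σ R) (d : σ →₀ ℕ) :
    MvPolynomial.coeff d (AddMonoidAlgebra.map l.toAddMonoidHom P : MvPolynomial σ R₂) =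
      l (MvPolynomial.coeff d P) :=
  rfl

/-- **Relative transfer (de-algebraizing the top of a tower).** `k` a field, `R₂` a finite
commutative `k`-algebra with `finrank_k R₂ ≤ s`, `R` a commutative `R₂`-algebra free over `R₂` with a
finite basis `b` indexed by `β`, `λ₁ : R →ₗ[R₂] R₂`, `λ₂ : R₂ →ₗ[k] k`.  If `f = λ₂ (λ₁ (det A))`
coefficientwise for an affine `m × m` matrix `A` over `R[x]`, then
`HasAlgDetRepr f ((m^3 + 2)·|β| + 3) s` — over the smaller algebra `R₂`.
[cite: HrubesYehudayoff2011, Thm. 1.1 and §4] -/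
theorem hasAlgDetRepr_of_tower {f : MvPolynomial σ k} {m s : ℕ}
    (R₂ : Type) [CommRing R₂] [Algebra k R₂] [Module.Finite k R₂] (hR₂ : Module.finrank k R₂ ≤ s)
    (R : Type) [CommRing R] [Algebra R₂ R] {β : Type} [Fintype β] [DecidableEq β]
    (b : Module.Basis β R₂ R) (l₁ : R →ₗ[R₂] R₂) (l₂ : R₂ →ₗ[k] k)
    (A : Matrix (Fin m) (Fin m) (MvPolynomial σ R)) (hA : ∀ i j, (A i j).totalDegree ≤ 1)
    (hf : ∀ d : σ →₀ ℕ, l₂ (l₁ (MvPolynomial.coeff d A.det)) = MvPolynomial.coeff d f) :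
    HasAlgDetRepr f ((m ^ 3 + 2) * Fintype.card β + 3) s := by
  rcases Nat.eq_zero_or_pos m with rfl | hm
  · -- `m = 0`: `det A = 1`, `f = C (λ₂ (λ₁ 1))`; witness `(R₂, λ₂ (λ₁ 1 · _), ∅)` padded
    have hdet : A.det = 1 := Matrix.det_isEmpty
    have h0 : HasAlgDetRepr f 0 s := by
      classical
      refine HasAlgDetRepr.of_data R₂ hR₂ (l₂ ∘ₗ LinearMap.mulLeft k (l₁ 1))
        (Matrix.of fun _ _ => 0) (fun i => Fin.elim0 i) fun d => ?_
      rw [← hf d, hdet, Matrix.det_isEmpty, LinearMap.comp_apply, LinearMap.mulLeft_apply,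
        MvPolynomial.coeff_one, MvPolynomial.coeff_one]
      split_ifs
      · rw [mul_one]
      · simp
    exact h0.mono (Nat.zero_le _) le_rfl
  · -- `m ≥ 1`: Mahajan–Vinay over `R`, affine substitution, unrolling along `b` read through `λ₁`
    have hdetR : LayeredABPComputes (m ^ 3 + 2) (detPoly (Fin m) R) := by
      have h := (layeredABPComputes_detPoly_of_algebra k R₂ m hm).map (algebraMap R₂ R)
      rwa [Literature.Computability.AlgebraicComplexity.map_detPoly] at h
    have hdetA : LayeredABPComputes (m ^ 3 + 2) A.det := by
      have h := hdetR.aeval_affine (fun p : Fin m × Fin m => A p.1 p.2) (fun p => hA p.1 p.2)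
      rwa [detPoly, AlgHom.map_det, Matrix.mvPolynomialX_mapMatrix_aeval] at h
    have hQ := hdetA.restrictScalars b l₁
    -- close the program over `R₂` into one affine determinant and read through `λ₂`
    obtain ⟨A', hA', hdet'⟩ := hQ.hasDetRepr
    refine HasAlgDetRepr.of_data R₂ hR₂ l₂ A' hA' fun d => ?_
    rw [hdet', coeff_map_toAddMonoidHom, hf d]
    -- sizes: `(m^3+2)·|β| + 2 + 1 = (m^3+2)·|β| + 3`

end Tower

/-! ### The tensor-factor instance -/

section Tensor

variable {σ : Type*}

/-- The `R₂`-linear read-out `id ⊗ λ₁ : R₂ ⊗ R₁ → R₂ ⊗ ℂ ≅ R₂` followed by `λ₂` is the pure-tensor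
functional `λ₂ ⊗ λ₁`: on `a ⊗ x` both give `λ₂ a · λ₁ x`. [folklore] -/
theorem tensor_readout_apply (R₁ R₂ : Type) [CommRing R₁] [Algebra ℂ R₁] [CommRing R₂] [Algebra ℂ R₂]
    (l₁ : R₁ →ₗ[ℂ] ℂ) (l₂ : R₂ →ₗ[ℂ] ℂ) (z : R₂ ⊗[ℂ] R₁) :
    l₂ ((TensorProduct.AlgebraTensorModule.rid ℂ R₂ R₂).toLinearMap (l₁.baseChange R₂ z)) =
      LinearMap.mul' ℂ ℂ (TensorProduct.map l₂ l₁ z) := by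
  induction z using TensorProduct.induction_on with
  | zero => simp
  | tmul a x =>
    simp [LinearMap.baseChange_tmul, mul_comm]
  | add u v hu hv =>
    simp only [map_add, hu, hv]

/-- **Partial de-algebraization along a tensor factor.** `R₁`, `R₂` finite commutative `ℂ`-algebras,
`λ₁ : R₁ → ℂ`, `λ₂ : R₂ → ℂ` linear, `A` an affine `m × m` matrix over `(R₂ ⊗ R₁)[x]` with
`f = (λ₂ ⊗ λ₁)(det A)` coefficientwise (pure-tensor read-out).  Then
`HasAlgDetRepr f ((m^3 + 2)·dim R₁ + 3) (dim R₂)`: the factor `R₁` is removed at polynomial cost in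
`(m, dim R₁)`, the factor `R₂` stays as coefficient algebra.
[cite: HrubesYehudayoff2011, Thm. 1.1 and §4] -/
theorem hasAlgDetRepr_of_tensor {f : MvPolynomial σ ℂ} {m : ℕ}
    (R₁ R₂ : Type) [CommRing R₁] [Algebra ℂ R₁] [Module.Finite ℂ R₁]
    [CommRing R₂] [Algebra ℂ R₂] [Module.Finite ℂ R₂]
    (l₁ : R₁ →ₗ[ℂ] ℂ) (l₂ : R₂ →ₗ[ℂ] ℂ)
    (A : Matrix (Fin m) (Fin m) (MvPolynomial σ (R₂ ⊗[ℂ] R₁)))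
    (hA : ∀ i j, (A i j).totalDegree ≤ 1)
    (hf : ∀ d : σ →₀ ℕ,
      LinearMap.mul' ℂ ℂ (TensorProduct.map l₂ l₁ (MvPolynomial.coeff d A.det)) =
        MvPolynomial.coeff d f) :
    HasAlgDetRepr f ((m ^ 3 + 2) * Module.finrank ℂ R₁ + 3) (Module.finrank ℂ R₂) := by
  classical
  -- `R₂ ⊗ R₁` is free over `R₂` on the base change of a `ℂ`-basis of `R₁`
  let b₁ := Module.finBasis ℂ R₁
  let b : Module.Basis (Fin (Module.finrank ℂ R₁)) R₂ (R₂ ⊗[ℂ] R₁) :=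
    Algebra.TensorProduct.basis R₂ b₁
  -- the `R₂`-linear read-out `id ⊗ λ₁`
  let l₁' : R₂ ⊗[ℂ] R₁ →ₗ[R₂] R₂ :=
    (TensorProduct.AlgebraTensorModule.rid ℂ R₂ R₂).toLinearMap ∘ₗ l₁.baseChange R₂
  have h := hasAlgDetRepr_of_tower (f := f) R₂ le_rfl (R₂ ⊗[ℂ] R₁) b l₁' l₂ A hA fun d => by
    rw [← hf d, LinearMap.comp_apply]
    exact tensor_readout_apply R₁ R₂ l₁ l₂ _
  rwa [Fintype.card_fin] at h

end Tensor

end Summit.ValiantsHypothesis.ValiantsHypothesis.Theorems.GrenetZeonAbelianizationQP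

end
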